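import Literature.Barriers.CriticalPhenomena.LaceExpansionConvolutionAsymptotics
import Literature.Barriers.CriticalPhenomena.LaceExpansionKernelFourier
import HarnessLib

/-!
# Hara's Gaussian lemma: Cor. 1.4 (`Hara2008_gaussianConvolution`) reduced to Thm. 1.3

Barrier catalogue `Literature/Barriers/CriticalPhenomena/` (D-0021), companion of
`LaceExpansionXSpaceAsymptotics.lean`. That file reduces the named fact `Hara2008_etaZeroXSpace`
(Heydenreich–van der Hofstad 2017, Thm. 11.4; Hara 2008, Thm. 1.1 for percolation) to two named
facts, one of which is `Hara2008_gaussianConvolution` — Hara 2008, Cor. 1.4 (quantitative half):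
the asymptotics of `H(x) = ∫_{[-π,π]^d} e^{ikx} ĝ(k)/(1 - Ĵ(k)) dk/(2π)^d` for a signed kernel `J`.
Hara proves Cor. 1.4 in one line from his **Theorem 1.3** (the same statement for
`C(x) = ∫ e^{ikx}/(1 - Ĵ(k))`, i.e. `g = δ₀`; ten pages of Fourier analysis, §2) and the convolution
Lemma 6.1(ii): "This is because `H(x) = (C*g)(x)`". This file formalises exactly that line:

* `haraC J x` — Hara's `C(x)` as a Bochner integral over the cube;
* NAMED FACT `Hara2008_thm13` — Thm. 1.3 with the error bound (1.20a), over the hypothesis bundle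
  `HaraKernelHyp` of `LaceExpansionXSpaceAsymptotics.lean` (the well-definedness of `C`, i.e. the
  integrability of `(1 - Ĵ)⁻¹` on `[-π,π]^d`, §2.1, is PROVED in `LaceExpansionKernelFourier.lean`);
* PROVED: `haraH_eq_tsum_mul_haraC` — `H(x) = Σ_y g(y) C(x-y)` and integrability of the integrand
  of `H`, by Fubini for the absolutely convergent sum `ĝ(k) = Σ_y g(y)e^{-ik·y}` against the
  integrable `(1 - Ĵ)⁻¹` (`continuous_latticeFT`, `norm_latticeFT_le`); `norm_haraC_le`;
* PROVED: `Hara2008_gaussianConvolution_of_thm13 : Hara2008_thm13 → Hara2008_gaussianConvolution`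
  (Lemma 6.1(ii) in the form `tsum_conv_riesz_asymptotics` with `σ = (ρ∧2)/d`, after making the
  eventual bound of Thm. 1.3 uniform by the boundedness of `C`), and the chained reduction
  `Hara2008_etaZeroXSpace_of_thm13 : Hara2008_thm13 → Hara2008_laceExpansionPc →
  Hara2008_etaZeroXSpace`.

What remains for `Hara2008_etaZeroXSpace_holds` is thus `Hara2008_thm13` (formalizable: Hara's
Lemmas 2.1–2.3 and the Gaussian `t`-integrals) and `Hara2008_laceExpansionPc` (the percolation
lace expansion at `p_c` for `d ≥ 11`, computer-assisted below `d = 19`).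

## References

* T. Hara, *Decay of correlations in nearest-neighbor self-avoiding walk, percolation, lattice
  trees and animals*, Ann. Probab. 36 (2008) 530–593 (arXiv:math-ph/0504021): §1.2.2
  (definitions (1.17) of `C(x)`, `H(x)`; Thm. 1.3 with (1.18)–(1.20a); Remark 2; Cor. 1.4 and
  its proof), §2.1 ("the integrability of `{1 - Ĵ(k)}⁻¹` by (1.18)"; `C = ∫₀^∞ I_t dt`), §2.6
  (proof of (1.20a), `T = |x|^{2-(ρ∧2)/d}`), §6 Lemma 6.1.
* M. Heydenreich, R. van der Hofstad, *Progress in High-Dimensional Percolation and Random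
  Graphs*, Springer 2017: Thm. 11.4 and (11.2.10)–(11.2.16) (pp. 137–139).
-/

noncomputable section

namespace Literature.Barriers.CriticalPhenomena

open MeasureTheory Filter Finset Literature.Probability.LatticeModels Literature.Probability.Percolation
open scoped Topology BigOperators

variable {d : ℕ}

/-! ### Hara's `C(x)` and the named fact for Theorem 1.3 -/

/-- Hara's `C(x) := ∫_{[-π,π]^d} (d^dk/(2π)^d) e^{ik·x}/(1 - Ĵ(k))`, "the two-point function of the
Gaussian spin system whose spins at `x` and `y` interact with `J(x-y)`" (a Bochner integral over
the cube; `H` for `g = δ₀`). [cite: Hara2008, §1.2.2 (definition of C(x), first line of the display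
before Thm. 1.3)] -/
def haraC (J : Site d → ℝ) (x : Site d) : ℂ :=
  (∫ k in cube d, Complex.exp (Complex.I * (kdot k x : ℂ)) / (1 - latticeFT J k)) /
    ((2 * Real.pi : ℂ) ^ d)

/-- NAMED FACT — **Hara's Gaussian lemma** (Hara 2008, Thm. 1.3, with the error bound (1.20a) of
its second half): "Let `d ≥ 3`. Suppose `ℤ^d`-symmetric `J(x)` satisfies, with finite positive `K₀`
through `K₃`: `Ĵ(0) := Σ_x J(x) = 1`, `Ĵ(0) - Ĵ(k) ≥ K₀|k|²/(2d)` (`k ∈ [-π,π]^d`);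
`Σ_x |x|²J(x) := K₁`, `Σ_x |x|²|J(x)| ≤ K₂`; `|J(x)| ≤ K₃⟦x⟧^{-(d+2)}`. Then `C(x)` of (1.17) is
well defined and satisfies `C(x) ∼ (a_d/K₁)|x|^{2-d}`. Suppose further that `J(x)` satisfies
`Σ_x |x|^{2+ρ}|J(x)| < K₂'`, `|J(x)| ≤ K₃'⟦x⟧^{-(d+2+ρ)}` with finite positive `ρ, K₂', K₃'`. Then
`C(x) = (a_d/K₁)⟦x⟧^{-(d-2)} + O(⟦x⟧^{-(d-2+(ρ∧2)/d)})`." Vendored: the quantitative conclusion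
(1.20a), unpacked as `∃ K R, ∀ |x| ≥ R, |C(x) - (a_d/K₁)|x|^{2-d}| ≤ K|x|^{-(d-2+(ρ∧2)/d)}`, under
the hypothesis bundle `HaraKernelHyp d J ρ` (which lists exactly (1.18)–(1.19) and (1.19')), with
`C(x)` the Bochner integral `haraC J x` (its well-definedness, "the integrability of
`{1 - Ĵ(k)}⁻¹` by (1.18)", ibid. §2.1, is proved: `integrableOn_inv_one_sub_latticeFT`); the
purely asymptotic first conclusion is not vendored. The printed proof is §2 of the paper
(Lemmas 2.1–2.3: `C = ∫₀^∞ I_t dt`, a large-`t` Gaussian approximation of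
`I_t(x) = ∫ e^{ikx - t(1-Ĵ(k))}` and a small-`t` bound by `d` integrations by parts, with
`T = |x|^{2-(ρ∧2)/d}`, §2.6). Users take `(h : Hara2008_thm13)`.
[cite: Hara2008, Thm. 1.3 ((1.18)–(1.20a)) and §2.6] -/
def Hara2008_thm13 : Prop :=
  ∀ (d : ℕ), 3 ≤ d → ∀ (J : Site d → ℝ) (ρ : ℝ), HaraKernelHyp d J ρ →
    ∃ K R : ℝ, ∀ x : Site d, R ≤ euclidNorm x →
      ‖haraC J x - ((gaussianAmp d / (∑' y, euclidNorm y ^ 2 * J y) *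
          euclidNorm x ^ (2 - (d : ℝ)) : ℝ) : ℂ)‖ ≤
        K * euclidNorm x ^ (-((d : ℝ) - 2 + min ρ 2 / d))

/-! ### `H = C * g`: Fubini -/

/-- **`H(x) = Σ_y g(y) C(x - y)`** ("`H(x) = (C*g)(x)`, where `*` denotes convolution", the one-line
proof of Cor. 1.4): if `(1 - Ĵ)⁻¹` is integrable on `[-π,π]^d` and `Σ|g| < ∞`, then the integrand of
`H(x)` is integrable and the `k`-integral may be exchanged with the absolutely convergent sum
defining `ĝ(k) = Σ_y g(y)e^{-ik·y}`. [cite: Hara2008, Cor. 1.4 (proof: "H(x) = (C*g)(x)")] -/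
theorem haraH_eq_tsum_mul_haraC {J g : Site d → ℝ}
    (hJ : IntegrableOn (fun k => (1 - latticeFT J k)⁻¹) (cube d)) (hg : Summable fun y => |g y|)
    (x : Site d) :
    IntegrableOn (haraIntegrand J g x) (cube d) ∧
      haraH J g x = ∑' y, (g y : ℂ) * haraC J (x - y) := by
  set μ : Measure (Fin d → ℝ) := volume.restrict (cube d) with hμ
  set h : (Fin d → ℝ) → ℂ := fun k => (1 - latticeFT J k)⁻¹ with hh
  have hJ' : Integrable h μ := hJ
  -- the summands
  set F : Site d → (Fin d → ℝ) → ℂ := fun y k =>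
    (g y : ℂ) * (Complex.exp (Complex.I * (kdot k (x - y) : ℂ)) * h k) with hF
  have hF_int : ∀ y, Integrable (F y) μ := by
    intro y
    refine Integrable.const_mul ?_ _
    refine hJ'.bdd_mul (continuous_cexp_I_mul_kdot (x - y)).aestronglyMeasurable
      (Filter.Eventually.of_forall fun k => (norm_cexp_I_mul_kdot k (x - y)).le)
  have hF_norm : ∀ y k, ‖F y k‖ = |g y| * ‖h k‖ := fun y k => by
    simp only [hF]; rw [norm_mul, norm_mul, Complex.norm_real, Real.norm_eq_abs, norm_cexp_I_mul_kdot, one_mul]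
  have hF_sum : Summable fun y => ∫ k, ‖F y k‖ ∂μ := by
    have : (fun y => ∫ k, ‖F y k‖ ∂μ) = fun y => |g y| * ∫ k, ‖h k‖ ∂μ := by
      funext y; simp_rw [hF_norm]; exact integral_const_mul _ _
    rw [this]; exact hg.mul_right _
  -- the integrand of `H` is the sum of the summands
  have hpt : ∀ k, haraIntegrand J g x k = ∑' y, F y k := by
    intro k
    simp only [haraIntegrand, latticeFT, hF, hh, div_eq_mul_inv]
    rw [← tsum_mul_right, ← tsum_mul_left]
    refine tsum_congr fun y => ?_
    rw [sub_eq_add_neg x y, kdot_add, kdot_neg, ← sub_eq_add_neg]; push_cast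
    rw [mul_sub, Complex.exp_sub, Complex.exp_neg]
    ring
  -- integrability of the integrand of `H`
  have hInt : Integrable (haraIntegrand J g x) μ := by
    have h1 : Integrable (fun k => latticeFT g k * h k) μ :=
      hJ'.bdd_mul (continuous_latticeFT hg).aestronglyMeasurable
        (Filter.Eventually.of_forall fun k => norm_latticeFT_le hg k)
    have h2 := h1.bdd_mul (continuous_cexp_I_mul_kdot x).aestronglyMeasurable
      (Filter.Eventually.of_forall fun k => (norm_cexp_I_mul_kdot k x).le)
    refine h2.congr (Filter.Eventually.of_forall fun k => ?_)
    simp only [haraIntegrand, hh, div_eq_mul_inv]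
  refine ⟨hInt, ?_⟩
  -- exchange sum and integral
  have hex : ∫ k, haraIntegrand J g x k ∂μ = ∑' y, ∫ k, F y k ∂μ := by
    rw [integral_congr_ae (Filter.Eventually.of_forall hpt)]
    exact (integral_tsum_of_summable_integral_norm hF_int hF_sum).symm
  have hpi : ((2 * Real.pi : ℂ) ^ d) ≠ 0 := pow_ne_zero _ (by
    have : (2 * Real.pi : ℂ) = ((2 * Real.pi : ℝ) : ℂ) := by push_cast; ring
    rw [this, Complex.ofReal_ne_zero]; positivity)
  have hFy : ∀ y, ∫ k, F y k ∂μ = (2 * Real.pi : ℂ) ^ d * ((g y : ℂ) * haraC J (x - y)) := by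
    intro y
    simp only [hF]
    rw [integral_const_mul]
    have : ∫ k, Complex.exp (Complex.I * (kdot k (x - y) : ℂ)) * h k ∂μ =
        (2 * Real.pi : ℂ) ^ d * haraC J (x - y) := by
      rw [haraC, mul_div_cancel₀ _ hpi]
      simp only [hh, hμ, div_eq_mul_inv]
    rw [this]; ring
  unfold haraH
  rw [hex, tsum_congr hFy, tsum_mul_left, mul_div_cancel_left₀ _ hpi]


/-- A uniform bound on `C(x)`: `|C(x)| ≤ (2π)^{-d} ∫ |1/(1 - Ĵ)|`. [folklore] -/
theorem norm_haraC_le {J : Site d → ℝ} (x : Site d) :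
    ‖haraC J x‖ ≤ (∫ k in cube d, ‖(1 - latticeFT J k)⁻¹‖) / ((2 * Real.pi) ^ d) := by
  unfold haraC
  rw [norm_div, norm_pow]
  have h2π : ‖(2 * Real.pi : ℂ)‖ = 2 * Real.pi := by
    rw [show (2 * Real.pi : ℂ) = ((2 * Real.pi : ℝ) : ℂ) by push_cast; ring, Complex.norm_real,
      Real.norm_eq_abs, abs_of_pos (by positivity)]
  rw [h2π]
  gcongr
  refine (norm_integral_le_integral_norm _).trans (le_of_eq (integral_congr_ae
    (Filter.Eventually.of_forall fun k => ?_)))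
  simp only [div_eq_mul_inv, norm_mul, norm_cexp_I_mul_kdot, one_mul]

/-! ### Corollary 1.4 from Theorem 1.3 -/

/-- **Hara 2008, Cor. 1.4 from Thm. 1.3, proved** ("Corollary 1.4 follows immediately from
Theorem 1.3 and a basic property of convolutions, Lemma 6.1. This is because `H(x) = (C*g)(x)`"):
granted the named fact `Hara2008_thm13`, the vendored convolution form
`Hara2008_gaussianConvolution` holds — by `haraH_eq_tsum_mul_haraC` (Fubini) and
`tsum_conv_riesz_asymptotics` (Lemma 6.1(ii)) with error exponent `σ = (ρ∧2)/d ≤ 2/3 < ρ`, the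
eventual bound of Thm. 1.3 being first made uniform in `x` by the boundedness of `C`.
[cite: Hara2008, Cor. 1.4 and its proof (§1.2.2)] -/
theorem Hara2008_gaussianConvolution_of_thm13 (h13 : Hara2008_thm13) : Hara2008_gaussianConvolution := by
  intro d hd J g ρ hK hS
  obtain ⟨K, R, hC⟩ := h13 d hd J ρ hK
  have hgs : Summable fun y => |g y| := hS.summable
  obtain ⟨K₀, hK₀, hlow⟩ := hK.lower
  have hint : IntegrableOn (fun k => (1 - latticeFT J k)⁻¹) (cube d) :=
    integrableOn_inv_one_sub_latticeFT hd hK.hasSum_one.summable.abs (IsZdSymmetric.neg hK.symm) hK₀ hlow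
  refine ⟨fun x => (haraH_eq_tsum_mul_haraC hint hgs x).1, ?_⟩
  have hd2 : 2 ≤ d := by omega
  have hdR : (3 : ℝ) ≤ d := by exact_mod_cast hd
  have hd0 : (0 : ℝ) < d := by linarith
  have hρ : 0 < ρ := hK.rho_pos
  -- the exponents
  set σ : ℝ := min ρ 2 / d with hσ_def
  have hσ0 : 0 < σ := div_pos (lt_min hρ two_pos) hd0
  have hσ1 : σ ≤ 1 := by
    rw [hσ_def, div_le_one hd0]; linarith [min_le_right ρ 2]
  have hσρ : σ < ρ := by
    rw [hσ_def, div_lt_iff₀ hd0]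
    have := min_le_left ρ 2
    nlinarith
  -- the constants of Thm. 1.3, made uniform in `x`
  set K₁ := ∑' y, euclidNorm y ^ 2 * J y with hK₁
  set a : ℝ := gaussianAmp d / K₁ with ha
  set A : ℂ := (a : ℂ) with hA
  set M : ℝ := (∫ k in cube d, ‖(1 - latticeFT J k)⁻¹‖) / ((2 * Real.pi) ^ d) with hM
  have hM0 : 0 ≤ M := by positivity
  set R' : ℝ := max R 1 with hR'
  have hR'1 : 1 ≤ R' := le_max_right _ _
  set s : ℝ := (d : ℝ) - 2 + σ with hs
  have hs0 : 0 ≤ s := by rw [hs]; linarith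
  set B : ℝ := max K ((M + ‖A‖) * R' ^ s) with hB
  have hf : ∀ z : Site d, ‖haraC J z - A * ((jnorm z ^ (2 - (d : ℝ)) : ℝ) : ℂ)‖ ≤ B * jnorm z ^ (-s) := by
    intro z
    by_cases hz : R' ≤ euclidNorm z
    · have hz1 : 1 ≤ euclidNorm z := hR'1.trans hz
      have hjz : jnorm z = euclidNorm z := jnorm_eq_euclidNorm hz1
      have h := hC z ((le_max_left R 1).trans hz)
      rw [hjz]
      calc ‖haraC J z - A * ((euclidNorm z ^ (2 - (d : ℝ)) : ℝ) : ℂ)‖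
          = ‖haraC J z - ((gaussianAmp d / K₁ * euclidNorm z ^ (2 - (d : ℝ)) : ℝ) : ℂ)‖ := by
            rw [hA, ha]; push_cast; ring_nf
        _ ≤ K * euclidNorm z ^ (-((d : ℝ) - 2 + min ρ 2 / d)) := h
        _ = K * euclidNorm z ^ (-s) := by rw [hs, hσ_def]
        _ ≤ B * euclidNorm z ^ (-s) :=
            mul_le_mul_of_nonneg_right (le_max_left _ _) (Real.rpow_nonneg (euclidNorm_nonneg z) _)
    · rw [not_le] at hz
      have hjz : jnorm z ≤ R' := max_le hz.le hR'1
      have hcrude : ‖haraC J z - A * ((jnorm z ^ (2 - (d : ℝ)) : ℝ) : ℂ)‖ ≤ M + ‖A‖ := by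
        calc _ ≤ ‖haraC J z‖ + ‖A * ((jnorm z ^ (2 - (d : ℝ)) : ℝ) : ℂ)‖ := norm_sub_le _ _
          _ ≤ M + ‖A‖ * 1 := by
              refine add_le_add (norm_haraC_le z) ?_
              rw [norm_mul]
              refine mul_le_mul_of_nonneg_left ?_ (norm_nonneg _)
              rw [Complex.norm_real, Real.norm_eq_abs, abs_of_nonneg (Real.rpow_nonneg (jnorm_pos z).le _)]
              exact jnorm_rpow_two_sub_le_one hd2 z
          _ = M + ‖A‖ := by ring
      have hpow : 1 ≤ R' ^ s * jnorm z ^ (-s) := by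
        have h1 : R' ^ (-s) ≤ jnorm z ^ (-s) := Real.rpow_le_rpow_of_nonpos (jnorm_pos z) hjz (by linarith)
        calc (1 : ℝ) = R' ^ s * R' ^ (-s) := by
              rw [← Real.rpow_add (by linarith), add_neg_cancel, Real.rpow_zero]
          _ ≤ R' ^ s * jnorm z ^ (-s) := by gcongr
      calc _ ≤ M + ‖A‖ := hcrude
        _ ≤ (M + ‖A‖) * (R' ^ s * jnorm z ^ (-s)) := le_mul_of_one_le_right (by positivity) hpow
        _ = (M + ‖A‖) * R' ^ s * jnorm z ^ (-s) := by ring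
        _ ≤ B * jnorm z ^ (-s) :=
            mul_le_mul_of_nonneg_right (le_max_right _ _) (Real.rpow_nonneg (jnorm_pos z).le _)
  -- the hypotheses on `g`
  obtain ⟨K₄', hK₄'⟩ := hS.decay_rho
  have hg : ∀ y, |g y| ≤ K₄' * jnorm y ^ (-((d : ℝ) + ρ)) := fun y => by
    rw [Real.rpow_neg (jnorm_pos y).le, ← div_eq_mul_inv]; exact hK₄' y
  have hge : ∀ y, g (-y) = g y := IsZdSymmetric.neg hS.symm
  -- Lemma 6.1(ii)
  obtain ⟨K', hK'⟩ := tsum_conv_riesz_asymptotics hd hf hg hge hσ0 hσρ hσ1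
  refine ⟨K', 1, fun x hx => ?_⟩
  have hjx : jnorm x = euclidNorm x := jnorm_eq_euclidNorm hx
  obtain ⟨-, hb⟩ := hK' x
  have hH : haraH J g x = ∑' y, haraC J (x - y) * (g y : ℂ) := by
    rw [(haraH_eq_tsum_mul_haraC hint hgs x).2]; exact tsum_congr fun y => mul_comm _ _
  rw [hH]
  rw [hjx] at hb
  calc ‖∑' y, haraC J (x - y) * (g y : ℂ) -
        (((∑' y, g y) / (∑' y, euclidNorm y ^ 2 * J y) * gaussianAmp d * euclidNorm x ^ (2 - (d : ℝ)) : ℝ) : ℂ)‖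
      = ‖∑' y, haraC J (x - y) * (g y : ℂ) -
          A * ((∑' y, g y : ℝ) : ℂ) * ((euclidNorm x ^ (2 - (d : ℝ)) : ℝ) : ℂ)‖ := by
        rw [hA, ha, hK₁]; push_cast; ring_nf
    _ ≤ K' * euclidNorm x ^ (-s) := hb
    _ = K' * euclidNorm x ^ (-((d : ℝ) - 2 + min ρ 2 / d)) := by rw [hs, hσ_def]

/-- **`Hara2008_etaZeroXSpace` reduced one level further**: the named facts `Hara2008_thm13`
(Hara 2008, Thm. 1.3: pure Fourier analysis on `[-π,π]^d`) and `Hara2008_laceExpansionPc` (the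
percolation lace expansion at `p_c`, `d ≥ 11`) imply `η = 0` in `x`-space for `d ≥ 11`
(Heydenreich–van der Hofstad 2017, Thm. 11.4). [cite: Hara2008, §1.2 (framework of the proof of Thm. 1.1)]
[cite: HeydenreichVanDerHofstad2017, Thm. 11.4 and pp. 137–139] -/
theorem Hara2008_etaZeroXSpace_of_thm13 (h13 : Hara2008_thm13) (hP : Hara2008_laceExpansionPc) :
    Hara2008_etaZeroXSpace :=
  Hara2008_etaZeroXSpace_of_framework (Hara2008_gaussianConvolution_of_thm13 h13) hP

end Literature.Barriers.CriticalPhenomena
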